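import Summits.CriticalPhenomena.PercolationContinuityZ3.Theorems.FK.FKSharpnessOSSS
import Summits.CriticalPhenomena.PercolationContinuityZ3.Theorems.FK.DualDecayPercolationCriteria
import HarnessLib

/-!
# THE CRITICAL VALUE OF THE RANDOM-CLUSTER MODEL ON THE SQUARE LATTICE: `p_c(q) = √q/(1+√q)` for every `q ≥ 1`
# (Beffara–Duminil-Copin 2012, via sharpness by decision trees: Duminil-Copin–Raoufi–Tassion 2019, Thm 1.3)

Claimed R42 (8)(c) in the cell INBOX at 2026-08-28T02:11:55Z by fkp-10a gen 352 (NEW CLAIM #2 of the gen), addressed to coordinator fk-4 g266 (seated 01:27Z 2026-08-28; R146 l.8252: row FO-10a-g352 = package g352-osss; its (κ) clause sends the FK instantiation to a new claim, R147); lineage row FO-10a-g352f (self-suggested), package g352-fkosss, label FS-H.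
Support file of the `fk-continuity` cell (lineage fkp-10a, `--supports stmt-CriticalPhenomena-4575`); builds on
p205010 (kernel theorem, internal audit signed; external expert review pending).  No definitions, no named facts,
no sorries; standard axioms.  Package `g352-fkosss` = THE FK INSTANTIATION of the OSSS inequality for monotonic measures
(row FO-10a-g352 `g352-osss`): Duminil-Copin–Raoufi–Tassion's Theorem 1.2 (sharpness of the random-cluster phase
transition on `ℤ^d`, `q ≥ 1`) and, on `ℤ²`, `p_c(q) = √q/(1+√q)`.  UNCONDITIONAL; nothing here touches FH / TP_FK / the
`_r3` binders of the cell.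

For the random-cluster model on `ℤ²` with cluster weight `q ≥ 1`, `rcCriticalProb 2 q = √q/(1+√q)` (`rcCriticalProb_two_eq`).
The lower bound `p_c(q) ≥ p_sd(q) = √q/(1+√q)` is the lineage's ZH-E `selfDual_le_rcCriticalProb` (Zhang's argument, Grimmett
Thm (6.17)(a)); the upper bound is the lineage's MR-C `rcCriticalProb_eq_selfDual_of_wired_exp_decay_below_selfDual` (Grimmett's
Lemma (6.28) / Thm (6.18) route: exponential decay of the wired radius law at every `p < p_sd` forces `p_c ≤ p_sd` by planar
duality), whose hypothesis is discharged by SHARPNESS (`FKSharpnessOSSS.lean`, DRT Thm 1.2 (1): exponential decay of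
`φ¹_{p,q}(0 ↔ ∂Λ_n)` for every `p < p_c(q)`) — every `p < p_sd ≤ p_c` is subcritical.  Consequences written out: exponential
decay of `φ^b_{p,q}(0 ↔ ∂Λ_n)` for every `p < √q/(1+√q)` and `θ¹(p,q) > 0` for every `p > √q/(1+√q)`; `q = 2` gives the critical
point `√2/(1+√2)` of the FK–Ising model (the lineage's `criticalFKIsingParam`), `q = 1` is Kesten's `p_c(ℤ²) = 1/2` again.
No definitions.

## References
* V. Beffara, H. Duminil-Copin, *The self-dual point of the two-dimensional random-cluster model is critical for q ≥ 1*,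
  Probab. Theory Related Fields 153 (2012) 511–542, Thm 1. [BeffaraDuminilCopin2012]
* H. Duminil-Copin, A. Raoufi, V. Tassion, Ann. of Math. 189 (2019) 75–99, Thm 1.3 / §4 (p_c = p_sd from Thm 1.2 and
  duality). [DuminilCopinRaoufiTassion2019]
* G. Grimmett, *The Random-Cluster Model*, Springer 2006, Conj. (6.15), Thm (6.17), Thm (6.18), Lemma (6.28). [Grimmett2006]
-/

noncomputable section

namespace Summit.CriticalPhenomena.PercolationContinuityZ3.Theorems.FK

namespace MonotonicOSSS

open MeasureTheory Finset Function Filter Topology Set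
open Literature.Probability.Percolation Literature.Probability.LatticeModels Literature.Barriers.CriticalPhenomena
open Literature.Probability.Percolation.DCT16

variable {q : ℝ}

/-- **THE SELF-DUAL POINT IS CRITICAL (Beffara–Duminil-Copin 2012; Grimmett's Conjecture (6.15))**: for the random-cluster
model on `ℤ²` with `q ≥ 1`, `p_c(q) = √q / (1 + √q)`. [cite: DuminilCopinRaoufiTassion2019, Thm 1.3 (p_c = p_sd on ℤ² from Thm 1.2 and duality)] -/
theorem rcCriticalProb_two_eq (hq : 1 ≤ q) : rcCriticalProb 2 q = Real.sqrt q / (1 + Real.sqrt q) := by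
  refine rcCriticalProb_eq_selfDual_of_wired_exp_decay_below_selfDual hq fun p hp0 hp => ?_
  exact rcLimit_exists_exp_decay_real_siteToBoundary_of_lt_rcCriticalProb le_rfl true hq hp0
    (hp.trans_le (selfDual_le_rcCriticalProb hq))

/-- **EXPONENTIAL DECAY BELOW THE SELF-DUAL POINT**: for `q ≥ 1`, `0 ≤ p < √q/(1+√q)` and `b ∈ {free, wired}`,
`∃ c > 0, ∀ n ≥ 1, φ^b_{p,q}(0 ↔ ∂Λ_n) ≤ e^{−cn}` on `ℤ²`. [cite: DuminilCopinRaoufiTassion2019, Thm 1.3 with Thm 1.2 (1)] -/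
theorem rcLimit_two_exp_decay_of_lt_selfDual (hq : 1 ≤ q) (b : Bool) {p : ℝ} (hp0 : 0 ≤ p)
    (hp : p < Real.sqrt q / (1 + Real.sqrt q)) :
    ∃ c : ℝ, 0 < c ∧ ∀ n : ℕ, 1 ≤ n → (rcLimit 2 b p q).real (siteToBoundary 2 n) ≤ Real.exp (-(c * n)) :=
  rcLimit_exists_exp_decay_real_siteToBoundary_of_lt_rcCriticalProb le_rfl b hq hp0 (by rwa [rcCriticalProb_two_eq hq])

/-- **PERCOLATION ABOVE THE SELF-DUAL POINT**: for `q ≥ 1` and `√q/(1+√q) < p ≤ 1`, `θ¹(p,q) > 0` on `ℤ²`.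
[cite: DuminilCopinRaoufiTassion2019, Thm 1.3 (p_c = p_sd)] -/
theorem thetaWired_two_pos_of_selfDual_lt (hq : 1 ≤ q) {p : ℝ} (hp : Real.sqrt q / (1 + Real.sqrt q) < p) (hp1 : p ≤ 1) :
    0 < thetaWired 2 p q := by
  have hs : 0 ≤ Real.sqrt q / (1 + Real.sqrt q) := by positivity
  exact thetaWired_pos_of_rcCriticalProb_lt ⟨hs.trans hp.le, hp1⟩ (by rwa [rcCriticalProb_two_eq hq])

/-- **THE MEAN-FIELD BOUND AT THE SELF-DUAL POINT**: for `q ≥ 1` and `p₁ ∈ (√q/(1+√q), 1)` there is `c > 0` with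
`θ¹(p,q) ≥ c (p − √q/(1+√q))` for all `p ∈ (√q/(1+√q), p₁]` on `ℤ²`. [cite: DuminilCopinRaoufiTassion2019, Thm 1.2 (2) with Thm 1.3] -/
theorem exists_pos_forall_thetaWired_two_ge (hq : 1 ≤ q) {p₁ : ℝ} (hp : Real.sqrt q / (1 + Real.sqrt q) < p₁) (hp1 : p₁ < 1) :
    ∃ c : ℝ, 0 < c ∧ ∀ p ∈ Set.Ioc (Real.sqrt q / (1 + Real.sqrt q)) p₁,
      c * (p - Real.sqrt q / (1 + Real.sqrt q)) ≤ thetaWired 2 p q := by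
  have h := exists_pos_forall_thetaWired_ge_mul_sub (d := 2) le_rfl hq (p₁ := p₁) (by rwa [rcCriticalProb_two_eq hq]) hp1
  rwa [rcCriticalProb_two_eq hq] at h

/-- `q = 2`: the critical point of the FK–Ising model on `ℤ²` is `√2/(1+√2)` (the lineage's `criticalFKIsingParam`; equivalently
`β_c = ½ log(1+√2)` for the planar Ising model through the Edwards–Sokal dictionary, not restated here).
[cite: DuminilCopinRaoufiTassion2019, Thm 1.3 (q = 2)] -/
theorem rcCriticalProb_two_two : rcCriticalProb 2 2 = Real.sqrt 2 / (1 + Real.sqrt 2) :=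
  rcCriticalProb_two_eq (by norm_num)

end MonotonicOSSS

end Summit.CriticalPhenomena.PercolationContinuityZ3.Theorems.FK
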